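import Summits.FinalStateConjecture.FinalStateConjecture.Theses.TangentProfileCensorship
import Summits.FinalStateConjecture.FinalStateConjecture.Theses.PhaseMixingCapture
import Summits.FinalStateConjecture.FinalStateConjecture.Theorems.WeakCosmicCensorshipMGHD.Negative.TruncatedMinkowski
import Literature.Geometry.Lorentzian.TameGenericityLocal
import Literature.Geometry.Lorentzian.TrivialDataAdmissible

/-!
# `TangentProfileCensorship.NakedDataTameExit` (crux stmt-FinalStateConjecture-17383, rank 2),
# negative-side support: honest top, lattice position, kill shape, the `IsMaximal` guard

Support file of the refuter's crux attack (vetting sweep, one cycle, 2026-08-17); `sorry`-free, no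
named facts, NO definitions (everything inlined, so that the file is kernel-reviewed).
`N := NakedDataTameExit` says: on every connected Hausdorff second-countable smooth `3`-manifold `Σ`,
through every admissible datum `D` which is NAKED (some maximal vacuum Cauchy development has
incomplete `𝓘⁺`, sojourn form) passes a LOCAL tame exit (one fixed end, tame, immersed at `0`,
injective, admissible members, members at `0 < ‖c‖ < ε` good) into the re-typed summit property
(an MGHD exists; every MGHD has complete `𝓘⁺` and settles: sub-extremal `N`-Kerr decomposition of
its self-determined exterior, `RaysStayInClosure`, honest `HasExhaustiveCharts`, `IsFutureOriented`).
Findings recorded here: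

* `not_finalStateConjecture_of_not_nakedDataTameExit` — HONEST TOP (contrapositive of
  `FinalStateConjecture → N`): a refutation of the crux refutes the typed summit (a naked admissible
  datum is exceptional; the summit's global tame witness curve is in particular a local one).
* `not_nakedDataTameExit_of_not_wccTame` — LATTICE: modulo the route's support item `MGHDExistence`
  the crux implies TAME weak cosmic censorship (`PhaseMixingCapture.WeakCosmicCensorshipTame`,
  stmt-17269: a censored-exceptional datum with an MGHD is naked, good ⊆ censored, local tame exits
  globalise by `isTameChristodoulouGeneric_of_local`), so every refutation of tame WCC — whose
  standing disproof `Cruxes/WeakCosmicCensorshipTame/Disproof.lean` found none — kills this crux, and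
  every load-bearing finding there (`Theorems/WeakCosmicCensorshipTame/Negative/*`) is a test of `N`.
* `not_nakedDataTameExit_of_trapped`, `not_nakedDataTameExit_iff` — KILL SHAPE: the crux fails iff
  ONE admissible naked datum is TRAPPED (every tame, immersed, injective admissible curve through it
  has non-good members at arbitrarily small nonzero parameters): a tame-stable smooth vacuum naked
  singularity. `exists_naked_of_not_nakedDataTameExit` — in particular any refutation exhibits a
  smooth, complete, one-ended, DR-asymptotically-flat VACUUM datum with a maximal development of
  incomplete `𝓘⁺`; none is constructible in the tree (no development is proved maximal) and none is in
  print (Rodnianski–Shlapentokh-Rothman arXiv:1912.08478 / Shlapentokh-Rothman arXiv:2204.09891,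
  Rem. 1.2: `C^{1,s}` across a cone, not smooth; the 2026 stability theorems of Singh–Zheng
  arXiv:2605.16095 Thm. 1.3 / Zheng arXiv:2605.16235 are Einstein–SCALAR, spherically symmetric, at
  threshold regularity `C^{1,k²/(1−k²)}` — "falsifying weak cosmic censorship for data of this
  regularity", p. 4 — not in the smooth admissible class). Contrapositively: if no admissible datum is
  naked (pointwise WCC in the smooth class, open) the crux holds VACUOUSLY.
* THE `IsMaximal` GUARD OF THE HYPOTHESIS IS LOAD-BEARING, precisely:
  `trivialData_exit_of_withoutMaximalHyp` — with `IsMaximal` dropped from the hypothesis the trivial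
  datum is already in scope (time-truncated Minkowski,
  `exists_vacuumCauchyDevelopment_trivialData_not_complete`), so the mutated crux asserts outright a
  tame good exit through `trivialData`; and `not_withoutMaximalHyp_of_not_finalStateConjecture` —
  modulo the true, here unconstructed fact "every admissible datum has SOME vacuum Cauchy development
  with incomplete `𝓘⁺`" (local existence + time truncation) the mutated crux is the WHOLE summit (no
  naked/censored case split, no `MGHDExistence`): the guard is exactly what confines the crux to the
  naked half of the exceptional set.

## References

* D. Christodoulou, CQG 16 (1999) A23, p. A24 (admissible class, positive codimension), pp. A26–A27
  (complete future null infinity).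
* M. Dafermos, J. Luk, arXiv:1710.01722, p. 5 and Conjecture 1 (weak cosmic censorship; final state).
* I. Rodnianski, Y. Shlapentokh-Rothman, arXiv:1912.08478, Thm. 1; Y. Shlapentokh-Rothman,
  arXiv:2204.09891, Rem. 1.2 (vacuum naked singularities, regularity across the cone).
* J. Singh, W. Zheng, arXiv:2605.16095, Thm. 1.3 (threshold-regularity stability, scalar field).
-/

noncomputable section

-- the doubled `FinalStateConjecture.FinalStateConjecture` path component trips dupNamespace
set_option linter.dupNamespace false

open Set Function
open scoped Manifold ContDiff

namespace Summit.FinalStateConjecture.FinalStateConjecture.Theorems.NakedDataTameExit.Negative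

open Literature.Geometry.Lorentzian
open Literature.Geometry.Lorentzian.InitialDataSet
  (IsTameDataFamily IsImmersedAtZero IsTameChristodoulouGeneric isTameChristodoulouGeneric_of_local)
open Summit.FinalStateConjecture.FinalStateConjecture.Theses.TangentProfileCensorship
  (NakedDataTameExit MGHDExistence)
open Summit.FinalStateConjecture.FinalStateConjecture.Theses.PhaseMixingCapture
  (WeakCosmicCensorshipTame)
open Summit.FinalStateConjecture.FinalStateConjecture.Theorems.WeakCosmicCensorshipMGHD.Negative
  (exists_vacuumCauchyDevelopment_trivialData_not_complete)

/-- **Honest top, contrapositive**: a refutation of the crux refutes the typed summit — a naked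
admissible datum is exceptional for the summit property, and the summit's GLOBAL tame witness curve
through it is in particular a local one (`ε = 1`). [cite: DafermosLuk2017, Conjecture 1] -/
theorem not_finalStateConjecture_of_not_nakedDataTameExit (hN : ¬ NakedDataTameExit) :
    ¬ FinalStateConjecture := by
  intro h
  refine hN fun X _ _ _ _ _ _ D hD hnaked ↦ ?_
  have hbad : ¬ ((∃ 𝒟 : VacuumCauchyDevelopment D, 𝒟.IsMaximal) ∧
      ∀ 𝒟 : VacuumCauchyDevelopment D, 𝒟.IsMaximal →
        Summit.FinalStateConjecture.HasCompleteNullInfinity 𝒟.toCauchyDevelopment ∧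
          ∃ (O : Set 𝒟.carrier) (d : FinalStateDecomposition 𝒟.toSpacetime O 2),
            (∀ i, Kerr.IsSubextremal (d.mass i) (d.spin i)) ∧
              O = Summit.FinalStateConjecture.exteriorOf 𝒟.toCauchyDevelopment d.charted ∧
                Summit.FinalStateConjecture.RaysStayInClosure 𝒟.toCauchyDevelopment O ∧
                  Summit.FinalStateConjecture.HasExhaustiveCharts d ∧
                    Summit.FinalStateConjecture.IsFutureOriented d) := by
    rintro ⟨-, hall⟩
    obtain ⟨𝒟, h𝒟, hinc⟩ := hnaked
    exact hinc (hall 𝒟 h𝒟).1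
  obtain ⟨e, F, hF, himm, h0, hinj, hadm, hesc⟩ := h X D ⟨hD, hbad⟩
  refine ⟨e, F, hF, himm, h0, hinj, hadm, 1, one_pos, fun c hc _ ↦ ?_⟩
  by_contra hbad'
  exact hesc c hc ⟨hadm c, hbad'⟩

/-- **Lattice: every refutation of TAME weak cosmic censorship kills the crux** (modulo the route's
support item `MGHDExistence` = Choquet-Bruhat–Geroch): under `MGHDExistence` the crux implies
`WeakCosmicCensorshipTame` — an exceptional datum of the censored property with an MGHD is naked, the
crux exits it locally into good ⊆ censored, and local tame exits globalise
(`isTameChristodoulouGeneric_of_local`). [cite: Christodoulou1999, p. A24] -/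
theorem not_nakedDataTameExit_of_not_wccTame (hM : MGHDExistence) (hW : ¬ WeakCosmicCensorshipTame) :
    ¬ NakedDataTameExit := by
  intro hN
  refine hW fun X _ _ _ _ _ _ ↦ isTameChristodoulouGeneric_of_local fun D hD hbad ↦ ?_
  have hnaked : ∃ 𝒟 : VacuumCauchyDevelopment D,
      𝒟.IsMaximal ∧ ¬ Summit.FinalStateConjecture.HasCompleteNullInfinity 𝒟.toCauchyDevelopment := by
    by_contra hno
    refine hbad ⟨hM X D hD, fun 𝒟 h𝒟 ↦ ?_⟩
    by_contra hinc
    exact hno ⟨𝒟, h𝒟, hinc⟩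
  obtain ⟨e, F, hF, himm, h0, hinj, hadm, ε, hε, hgood⟩ := hN X D hD hnaked
  exact ⟨e, F, hF, himm, h0, hinj, hadm, ε, hε,
    fun c hc hcε ↦ ⟨(hgood c hc hcε).1, fun 𝒟 h𝒟 ↦ ((hgood c hc hcε).2 𝒟 h𝒟).1⟩⟩

/-- **Kill shape (sufficient form)**: ONE admissible naked datum `d` on one `Σ` such that every tame
(on any one end), immersed, injective admissible curve through `d` has, for every `ε > 0`, a member
`F c`, `0 < ‖c‖ < ε`, which is not good, refutes the crux. [cite: Christodoulou1999, p. A24] -/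
theorem not_nakedDataTameExit_of_trapped {X : Type} [TopologicalSpace X] [ChartedSpace E3 X]
    [IsManifold (𝓡 3) ∞ X] [T2Space X] [SecondCountableTopology X] [ConnectedSpace X]
    {d : InitialDataSet (𝓡 3) X} (hd : d ∈ admissibleVacuumData X)
    (hn : ∃ 𝒟 : VacuumCauchyDevelopment d,
      𝒟.IsMaximal ∧ ¬ Summit.FinalStateConjecture.HasCompleteNullInfinity 𝒟.toCauchyDevelopment)
    (htrap : ∀ (e : AFEnd X) (F : EuclideanSpace ℝ (Fin 1) → InitialDataSet (𝓡 3) X),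
      IsTameDataFamily e 1 F → IsImmersedAtZero 1 F → F 0 = d → Injective F →
        (∀ c, F c ∈ admissibleVacuumData X) →
          ∀ ε : ℝ, 0 < ε → ∃ c, c ≠ 0 ∧ ‖c‖ < ε ∧
            ¬ ((∃ 𝒟 : VacuumCauchyDevelopment (F c), 𝒟.IsMaximal) ∧
                ∀ 𝒟 : VacuumCauchyDevelopment (F c), 𝒟.IsMaximal →
                  Summit.FinalStateConjecture.HasCompleteNullInfinity 𝒟.toCauchyDevelopment ∧
                    ∃ (O : Set 𝒟.carrier) (d : FinalStateDecomposition 𝒟.toSpacetime O 2),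
                      (∀ i, Kerr.IsSubextremal (d.mass i) (d.spin i)) ∧
                        O = Summit.FinalStateConjecture.exteriorOf 𝒟.toCauchyDevelopment d.charted ∧
                          Summit.FinalStateConjecture.RaysStayInClosure 𝒟.toCauchyDevelopment O ∧
                            Summit.FinalStateConjecture.HasExhaustiveCharts d ∧
                              Summit.FinalStateConjecture.IsFutureOriented d)) :
    ¬ NakedDataTameExit := by
  intro hN
  obtain ⟨e, F, hF, himm, h0, hinj, hadm, ε, hε, hgood⟩ := hN X d hd hn
  obtain ⟨c, hc, hcε, hbad⟩ := htrap e F hF himm h0 hinj hadm ε hε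
  exact hbad (hgood c hc hcε)

/-- **Kill shape (exact)**: the crux fails iff some admissible naked datum on some `Σ` is trapped in
the sense of `not_nakedDataTameExit_of_trapped` — a tame-stable smooth vacuum naked singularity.
[cite: Christodoulou1999, p. A24] -/
theorem not_nakedDataTameExit_iff :
    ¬ NakedDataTameExit ↔
      ∃ (X : Type) (_ : TopologicalSpace X) (_ : ChartedSpace E3 X) (_ : IsManifold (𝓡 3) ∞ X)
        (_ : T2Space X) (_ : SecondCountableTopology X) (_ : ConnectedSpace X),
        ∃ d ∈ admissibleVacuumData X,
          (∃ 𝒟 : VacuumCauchyDevelopment d,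
            𝒟.IsMaximal ∧ ¬ Summit.FinalStateConjecture.HasCompleteNullInfinity 𝒟.toCauchyDevelopment) ∧
          ∀ (e : AFEnd X) (F : EuclideanSpace ℝ (Fin 1) → InitialDataSet (𝓡 3) X),
            IsTameDataFamily e 1 F → IsImmersedAtZero 1 F → F 0 = d → Injective F →
              (∀ c, F c ∈ admissibleVacuumData X) →
                ∀ ε : ℝ, 0 < ε → ∃ c, c ≠ 0 ∧ ‖c‖ < ε ∧
                  ¬ ((∃ 𝒟 : VacuumCauchyDevelopment (F c), 𝒟.IsMaximal) ∧
                      ∀ 𝒟 : VacuumCauchyDevelopment (F c), 𝒟.IsMaximal →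
                        Summit.FinalStateConjecture.HasCompleteNullInfinity 𝒟.toCauchyDevelopment ∧
                          ∃ (O : Set 𝒟.carrier) (d : FinalStateDecomposition 𝒟.toSpacetime O 2),
                            (∀ i, Kerr.IsSubextremal (d.mass i) (d.spin i)) ∧
                              O = Summit.FinalStateConjecture.exteriorOf 𝒟.toCauchyDevelopment
                                d.charted ∧
                                Summit.FinalStateConjecture.RaysStayInClosure 𝒟.toCauchyDevelopment O ∧
                                  Summit.FinalStateConjecture.HasExhaustiveCharts d ∧
                                    Summit.FinalStateConjecture.IsFutureOriented d) := by
  constructor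
  · intro h
    by_contra hno
    refine h fun X _ _ _ _ _ _ d hd hn ↦ ?_
    by_contra hexit
    refine hno ⟨X, ‹_›, ‹_›, ‹_›, ‹_›, ‹_›, ‹_›, d, hd, hn, fun e F hF himm h0 hinj hadm ε hε ↦ ?_⟩
    by_contra hc
    push Not at hc
    exact hexit ⟨e, F, hF, himm, h0, hinj, hadm, ε, hε, fun c hc0 hcε ↦ hc c hc0 hcε⟩
  · rintro ⟨X, _, _, _, _, _, _, d, hd, hn, htrap⟩
    exact not_nakedDataTameExit_of_trapped hd hn htrap

/-- **Any refutation exhibits a smooth admissible vacuum NAKED datum** (with a maximal development of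
incomplete `𝓘⁺`): contrapositively, if no admissible datum on any `Σ` is naked — pointwise weak cosmic
censorship in the smooth admissible class, open — the crux holds vacuously. No such datum is
constructible in the tree or available in print (the vacuum examples of arXiv:1912.08478 /
arXiv:2204.09891 are `C^{1,s}` across a cone). [cite: Christodoulou1999, p. A27] -/
theorem exists_naked_of_not_nakedDataTameExit (hN : ¬ NakedDataTameExit) :
    ∃ (X : Type) (_ : TopologicalSpace X) (_ : ChartedSpace E3 X) (_ : IsManifold (𝓡 3) ∞ X)
      (_ : T2Space X) (_ : SecondCountableTopology X) (_ : ConnectedSpace X),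
      ∃ d ∈ admissibleVacuumData X, ∃ 𝒟 : VacuumCauchyDevelopment d,
        𝒟.IsMaximal ∧ ¬ Summit.FinalStateConjecture.HasCompleteNullInfinity 𝒟.toCauchyDevelopment := by
  obtain ⟨X, _, _, _, _, _, _, d, hd, hn, -⟩ := not_nakedDataTameExit_iff.1 hN
  exact ⟨X, ‹_›, ‹_›, ‹_›, ‹_›, ‹_›, ‹_›, d, hd, hn⟩

/-- **The `IsMaximal` guard of the hypothesis, I.** With `IsMaximal` DROPPED from the hypothesis (any
vacuum Cauchy development with incomplete `𝓘⁺` triggers the exit; statement inlined as `h`), the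
trivial datum on the Minkowski slice is already in scope — its hypothesis is met by time-truncated
Minkowski space (`exists_vacuumCauchyDevelopment_trivialData_not_complete`) — so the mutated crux
asserts OUTRIGHT a tame good exit through `trivialData` (small-data settling along a tame curve, in
the re-typed sense; true in expectation, provable by nobody today). [cite: Christodoulou1999, p. A27] -/
theorem trivialData_exit_of_withoutMaximalHyp
    (h : ∀ (X : Type) [TopologicalSpace X] [ChartedSpace E3 X] [IsManifold (𝓡 3) ∞ X] [T2Space X]
      [SecondCountableTopology X] [ConnectedSpace X],
      ∀ D ∈ admissibleVacuumData X,
        (∃ 𝒟 : VacuumCauchyDevelopment D,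
          ¬ Summit.FinalStateConjecture.HasCompleteNullInfinity 𝒟.toCauchyDevelopment) →
          ∃ (e : AFEnd X) (F : EuclideanSpace ℝ (Fin 1) → InitialDataSet (𝓡 3) X),
            IsTameDataFamily e 1 F ∧ IsImmersedAtZero 1 F ∧ F 0 = D ∧ Injective F ∧
              (∀ c, F c ∈ admissibleVacuumData X) ∧
                ∃ ε : ℝ, 0 < ε ∧ ∀ c, c ≠ 0 → ‖c‖ < ε →
                  (∃ 𝒟 : VacuumCauchyDevelopment (F c), 𝒟.IsMaximal) ∧
                    ∀ 𝒟 : VacuumCauchyDevelopment (F c), 𝒟.IsMaximal →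
                      Summit.FinalStateConjecture.HasCompleteNullInfinity 𝒟.toCauchyDevelopment ∧
                        ∃ (O : Set 𝒟.carrier) (d : FinalStateDecomposition 𝒟.toSpacetime O 2),
                          (∀ i, Kerr.IsSubextremal (d.mass i) (d.spin i)) ∧
                            O = Summit.FinalStateConjecture.exteriorOf 𝒟.toCauchyDevelopment
                              d.charted ∧
                              Summit.FinalStateConjecture.RaysStayInClosure 𝒟.toCauchyDevelopment O ∧
                                Summit.FinalStateConjecture.HasExhaustiveCharts d ∧
                                  Summit.FinalStateConjecture.IsFutureOriented d) :
    ∃ (e : AFEnd Minkowski.slice)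
      (F : EuclideanSpace ℝ (Fin 1) → InitialDataSet (𝓡 3) Minkowski.slice),
      IsTameDataFamily e 1 F ∧ IsImmersedAtZero 1 F ∧ F 0 = trivialData ∧ Injective F ∧
        (∀ c, F c ∈ admissibleVacuumData Minkowski.slice) ∧
          ∃ ε : ℝ, 0 < ε ∧ ∀ c, c ≠ 0 → ‖c‖ < ε →
            (∃ 𝒟 : VacuumCauchyDevelopment (F c), 𝒟.IsMaximal) ∧
              ∀ 𝒟 : VacuumCauchyDevelopment (F c), 𝒟.IsMaximal →
                Summit.FinalStateConjecture.HasCompleteNullInfinity 𝒟.toCauchyDevelopment ∧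
                  ∃ (O : Set 𝒟.carrier) (d : FinalStateDecomposition 𝒟.toSpacetime O 2),
                    (∀ i, Kerr.IsSubextremal (d.mass i) (d.spin i)) ∧
                      O = Summit.FinalStateConjecture.exteriorOf 𝒟.toCauchyDevelopment d.charted ∧
                        Summit.FinalStateConjecture.RaysStayInClosure 𝒟.toCauchyDevelopment O ∧
                          Summit.FinalStateConjecture.HasExhaustiveCharts d ∧
                            Summit.FinalStateConjecture.IsFutureOriented d :=
  h Minkowski.slice trivialData trivialData_mem_admissibleVacuumData
    exists_vacuumCauchyDevelopment_trivialData_not_complete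

/-- **The `IsMaximal` guard of the hypothesis, II.** Modulo the (true, here unconstructed) fact
`hT` that every admissible datum has SOME vacuum Cauchy development with incomplete `𝓘⁺` (local
existence, then truncation in a Cauchy time function), the crux with `IsMaximal` dropped from the
hypothesis is the WHOLE typed summit — every admissible datum meets the mutated hypothesis, so the
mutated crux is a local tame good exit through EVERY admissible datum, which globalises with no
naked/censored case split and no `MGHDExistence`. Stated contrapositively: a refutation of the summit
refutes the unguarded crux. The guard is what confines the crux to the naked half of the exceptional
set. [cite: ChoquetBruhatGeroch1969CMP, p. 330] -/
theorem not_withoutMaximalHyp_of_not_finalStateConjecture (hS : ¬ FinalStateConjecture)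
    (hT : ∀ (X : Type) [TopologicalSpace X] [ChartedSpace E3 X] [IsManifold (𝓡 3) ∞ X] [T2Space X]
      [SecondCountableTopology X] [ConnectedSpace X],
      ∀ D ∈ admissibleVacuumData X,
        ∃ 𝒟 : VacuumCauchyDevelopment D,
          ¬ Summit.FinalStateConjecture.HasCompleteNullInfinity 𝒟.toCauchyDevelopment) :
    ¬ ∀ (X : Type) [TopologicalSpace X] [ChartedSpace E3 X] [IsManifold (𝓡 3) ∞ X] [T2Space X]
      [SecondCountableTopology X] [ConnectedSpace X],
      ∀ D ∈ admissibleVacuumData X,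
        (∃ 𝒟 : VacuumCauchyDevelopment D,
          ¬ Summit.FinalStateConjecture.HasCompleteNullInfinity 𝒟.toCauchyDevelopment) →
          ∃ (e : AFEnd X) (F : EuclideanSpace ℝ (Fin 1) → InitialDataSet (𝓡 3) X),
            IsTameDataFamily e 1 F ∧ IsImmersedAtZero 1 F ∧ F 0 = D ∧ Injective F ∧
              (∀ c, F c ∈ admissibleVacuumData X) ∧
                ∃ ε : ℝ, 0 < ε ∧ ∀ c, c ≠ 0 → ‖c‖ < ε →
                  (∃ 𝒟 : VacuumCauchyDevelopment (F c), 𝒟.IsMaximal) ∧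
                    ∀ 𝒟 : VacuumCauchyDevelopment (F c), 𝒟.IsMaximal →
                      Summit.FinalStateConjecture.HasCompleteNullInfinity 𝒟.toCauchyDevelopment ∧
                        ∃ (O : Set 𝒟.carrier) (d : FinalStateDecomposition 𝒟.toSpacetime O 2),
                          (∀ i, Kerr.IsSubextremal (d.mass i) (d.spin i)) ∧
                            O = Summit.FinalStateConjecture.exteriorOf 𝒟.toCauchyDevelopment
                              d.charted ∧
                              Summit.FinalStateConjecture.RaysStayInClosure 𝒟.toCauchyDevelopment O ∧
                                Summit.FinalStateConjecture.HasExhaustiveCharts d ∧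
                                  Summit.FinalStateConjecture.IsFutureOriented d := by
  intro h
  refine hS fun X _ _ _ _ _ _ ↦ ?_
  exact isTameChristodoulouGeneric_of_local fun D hD _ ↦ h X D hD (hT X D hD)

end Summit.FinalStateConjecture.FinalStateConjecture.Theorems.NakedDataTameExit.Negative

end
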